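import Literature.Computability.AlgebraicComplexity.AlmanLi2026AppendSlice
import Literature.Computability.AlgebraicComplexity.AlmanLi2026FreeLunchSpeedup
import HarnessLib

/-!
# Prop. 5.4 feeds Thm. 5.1: the appended-slice restriction admits the free-lunch speedup (Alman–Li 2026, §5.3)

Topic `Literature/Computability/AlgebraicComplexity` (family `MatrixMultiplication`). Source: J. Alman,
B. Li, *Asymptotic Rank Speedup Theorems, Revisited*, arXiv:2605.21738 (2026), §5.3: Proposition 5.4
("One-slice speedup [Str88AsymSpec]") — "there exists a restriction `T ≤ S ⊕ ⟨1,s,1⟩` extending `A, B, C`,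
such that there exists a linear function `f' : (W ⊕ 𝔽) → 𝔽` […] satisfying the conditions of
(prop:freelunch_oneslice) with `r = q+s`" (held text `paper:arxiv-2605.21738`, p. 13 L64 – p. 14 L20) —
combined with Theorem 5.1 (free-lunch speedup, p. 12), both read first-hand.

This leaf file only JOINS the two companion files: `AlmanLi2026AppendSlice.lean` constructs the extended
restriction `T = [(A P) ⊗ (B Q) ⊗ (C 0)](S ⊕ ⟨1,s,1⟩)` (`AlmanLi2026.prop54_restriction`) and proves that
`f' = (f, −1)` annihilates it (`AlmanLi2026.prop54_annihilates`); `AlmanLi2026FreeLunchSpeedup.lean` proves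
Thm. 5.1 (`AlmanLi2026.thm51`). The statement below is the one-line application announced in the module
docstring of `AlmanLi2026AppendSlice.lean` ("that one-line application is left to the file importing
both"): for every choice of rows `A''`, `B''` in the two annihilator subspaces of Thm. 5.1 (taken with
respect to `(A P)`, `(B Q)`, `f'`), `T ⊕ T' ⊴ S ⊕ ⟨1,s,1⟩` with `T' = (A'' ⊗ B'' ⊗ f')(S ⊕ ⟨1,s,1⟩)`.
Coordinates as in the companions (tensors `ι → κ → μ → K`; the slice `⟨1,s,1⟩` with trivial mode THIRD is
`rotate (oneSliceTensor K σ)`); any commutative ring `K`. The rank count `r = q + s` (Prop. 5.3 / the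
dimension of the annihilators) is not part of this statement; it is carried out in
`AlmanLi2026OneFunctionalSpeedup.lean`.

## References

* J. Alman, B. Li, arXiv:2605.21738 (2026), Prop. 5.4 and its proof (pp. 13–14); Thm. 5.1 (p. 12).
  [AlmanLi2026]
* V. Strassen, *The asymptotic spectrum of tensors*, J. reine angew. Math. 384 (1988) 102–152 (the
  attribution "[Str88AsymSpec]" of the proposition). [Strassen1988]
-/

noncomputable section

open scoped BigOperators

namespace Literature.Computability.AlgebraicComplexity

universe u

variable {K : Type u}
variable {ι κ μ ι' κ' μ' σ α β : Type*}

namespace AlmanLi2026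

/-- **Alman–Li 2026, Prop. 5.4 combined with Thm. 5.1** ("satisfying the conditions of
(prop:freelunch_oneslice)"): with the extended restriction `T = [(A P) ⊗ (B Q) ⊗ (C 0)](S ⊕ ⟨1,s,1⟩)`
and the annihilating functional `f' = (f, −1)` of Prop. 5.4, every choice of rows `A''`, `B''` in the
two annihilator subspaces of Thm. 5.1 (with respect to `(A P)`, `(B Q)`, `f'`) gives
`T ⊕ T' ⊴ S ⊕ ⟨1,s,1⟩` with `T' = (A'' ⊗ B'' ⊗ f')(S ⊕ ⟨1,s,1⟩)`.
[cite: AlmanLi2026, Prop. 5.4 with Thm. 5.1] -/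
theorem prop54_freeLunch [CommRing K] [Fintype ι] [Fintype κ] [Fintype μ] [Fintype σ]
    [DecidableEq σ] {S : ι → κ → μ → K} {A : ι' → ι → K} {B : κ' → κ → K} {C₀ : μ' → μ → K}
    {T : ι' → κ' → μ' → K} {f : μ → K} {P : ι' → σ → K} {Q : κ' → σ → K}
    (hT : ∀ a' b' c', T a' b' c' = ∑ a, ∑ b, ∑ c, A a' a * B b' b * C₀ c' c * S a b c)
    (hM : ∀ a' b', (∑ a, ∑ b, ∑ c, A a' a * B b' b * f c * S a b c) = ∑ i, P a' i * Q b' i)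
    {A'' : α → ι ⊕ σ → K} {B'' : β → κ ⊕ σ → K} {T' : α → β → Unit → K}
    (hT' : ∀ x y z, T' x y z = ∑ a, ∑ b, ∑ c, A'' x a * B'' y b *
      Sum.elim f (fun _ : Unit => (-1 : K)) c * directSumTensor S (rotate (oneSliceTensor K σ)) a b c)
    (hA'' : ∀ x b' (z : Unit), (∑ a, ∑ b, ∑ c, A'' x a * Sum.elim (B b') (Q b') b *
      Sum.elim f (fun _ : Unit => (-1 : K)) c * directSumTensor S (rotate (oneSliceTensor K σ)) a b c) = 0)
    (hB'' : ∀ a' y (z : Unit), (∑ a, ∑ b, ∑ c, Sum.elim (A a') (P a') a * B'' y b *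
      Sum.elim f (fun _ : Unit => (-1 : K)) c * directSumTensor S (rotate (oneSliceTensor K σ)) a b c) = 0) :
    AlgDegeneratesTo (directSumTensor S (rotate (oneSliceTensor K σ))) (directSumTensor T T') :=
  thm51 (A := fun a' => Sum.elim (A a') (P a')) (B := fun b' => Sum.elim (B b') (Q b'))
    (C₀ := fun c' => Sum.elim (C₀ c') (fun _ => (0 : K)))
    (C' := fun _ : Unit => Sum.elim f (fun _ : Unit => (-1 : K)))
    (fun a' b' c' => prop54_restriction P Q hT a' b' c') hT'
    (fun a' b' z => prop54_annihilates hM a' b' z) (fun x b' z => hA'' x b' z) (fun a' y z => hB'' a' y z)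

end AlmanLi2026

end Literature.Computability.AlgebraicComplexity
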